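import Summits.QuantumFields.YangMills.Theorems.BalabanUVNodesN18EnvelopeAtRecord
import Summits.QuantumFields.YangMills.Theorems.BalabanUVNodesN18HLayerDatum

/-!
# BalabanUVNodes ∕ node N18 = NE5 — `N18At` ON THE CARRIERS OF RECORD WITH W2 := TERM-LEVEL (2.26) DATA: the H-layer knit of
# `BalabanUVNodesN18EnvelopeAtRecord` (seat n18-d) composed BY NAME with the H-layer activity datum producer of
# `BalabanUVNodesN18HLayerDatum` (seat n18-c) — the NODE-A majorant binder `hH` DISCHARGED from per-term (hol) + (2.26) data

Cell `pub-ymgap`, HUMAN RULING D-0062 (Track A), R134 seat `pub-ymgap-dag-n18-d` (strategy s2: by-name knit), generation 0, module 2.  THEOREMS ONLY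
(0 `def`); imports this seat's module 1 (p451455: `YMDAG.N18.HLayer.n18At_of_envelopeOnRecord` — `N18At` at the H-layer bundle on
`B13Carriers.TwoRuns.carriers`, member by member, NODE-A majorant `hH` as hypothesis) and seat n18-c's module 1 (p450706:
`N18HLayerDatum.ne5_of_leaves_fibre_terms226_record_eps` — route P1's END on the carriers of record with the H-layer datum MANUFACTURED from the
(2.26)-term layer in the data direction: activities `act j z Z := Σ_{t ∈ terms L M Z} T j Z t z` over the printed term catalogue of `H(Z)`, (hol) every
term holomorphic in the data on an open `V ⊇ M.box j p`, (226) the per-term bound (2.26) UNIFORM on `V`, and [II] Lemma 3's printed restrictions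
on the constants); modifies nothing; `--supports stmt-QuantumFields-19676` (K3).

WHAT THIS FILE DOES.  `n18At_of_terms226_record` — `N18At ⟨Rr.carriers, W, γ, κ, EA, EB, θ′, C₅(C₃ε₁), …⟩` for EVERY two-run datum `Rr : TwoRuns G`
from, per member `b ∈ ]0, γ]` of run B's first-coupling family: a step model `M b` whose output IS (2.13) of the TERM SUMS (`hrep`), term functions
`T b j Z t : Op × Hist → ℂ` with the ∃V-form of (hol) + (226) around every admissible box (`hT`), the leaves L01–L03 ∕ L06–L09unit; and ONCE: Lemma 3's
restrictions (n18-c's `Numerics` block verbatim), L05, the located numerals at NE5's rate `κ` and the sharp clause — n18-c's END applied at each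
member (exactly as module 1 applies `EnvelopeOnRecord`'s); `n18At_of_terms226_record_eps` — the same with both W2 clauses as ONE threshold on the
record's small-field parameter `c.ε₁` (`EnvelopeOnRecord.eps_threshold_record`), the member data quantified after it.  So at the `N18At` ∕ `S_N18` level (through module 1's `s_N18_of_comap` or n18-a's
`s_N18_of_refines` at a rate-record home) route P1's residual for N18 is AT THE (2.26)-TERM LAYER: per term `(𝐃, P)` of Bałaban's `H(Z)`, holomorphy in
the step's data and (2.26) on the data box — NODE A's per-term estimate on the class (1.5) + NODE O's term objects — plus the END's other leaves.
HONEST FRAMING.  Count-neutral kernel bookkeeping BY NAME; 0 sorry; restates nothing.  (hol) + (226) for Bałaban's ACTUAL terms, the leaves and the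
term functions as functions of the step's data are HYPOTHESES instanced by nobody; NE5 NOT IN PRINT ([Balaban1987RG1] Thm 1 p. 259) ∕ NOT proved;
no rate-record home has landed; N18 NOT discharged (typed 28∕28 · discharged 5∕28 unmoved).  One finite four-torus at fixed ε; NOT infinite volume,
NOT OS on ℝ⁴, NOT a mass gap, NOT Clay.
-/

noncomputable section

open Set Metric Finset

namespace YMDAG.N18.HLayer

open Literature.MathematicalPhysics.QuantumFieldTheory.Balaban1983to89
open Literature.MathematicalPhysics.QuantumFieldTheory.Balaban1983to89.T4OutputRate (Functional)
open Literature.MathematicalPhysics.QuantumFieldTheory.Balaban1983to89.T4InputCauchyRateData (StepModel)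
open Literature.MathematicalPhysics.QuantumFieldTheory.Balaban1983to89.B13Resummation (locE)
open Literature.MathematicalPhysics.QuantumFieldTheory.Balaban1983to89.TreeLengthTorus (TDom tsys torusTreeLen)
open Literature.MathematicalPhysics.QuantumFieldTheory.Balaban1983to89.TreeLengthTorusGeometry (TTouch)
open Literature.MathematicalPhysics.QuantumFieldTheory.Balaban1983to89.B13Lemma3TorusData (TBond)
open Literature.MathematicalPhysics.QuantumFieldTheory.Balaban1983to89.B13Lemma3TorusTerms (terms weight)
open Literature.MathematicalPhysics.QuantumFieldTheory.Balaban1983to89.B12TreeDecay (kappa₀ K₀)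
open Summit.QuantumFields.BalabanUV.T4Continuum.B13Carriers (TwoRuns)
open Summit.QuantumFields.BalabanUV.T4Continuum.Spine.NE5
open Summit.QuantumFields.YangMills.BalabanUVNodes.N18HLayerDatum (ne5_of_leaves_fibre_terms226_record_eps)
open YMDAG.UVSplit

section Numerics

/-! [II] Lemma 3's printed restrictions on the constants — n18-c's `Numerics` block VERBATIM (one set for all scales and all members). -/

variable {L Mb : ℕ} [NeZero L] [NeZero Mb] (c : B13.Consts) (hL : 8 ≤ c.L) (hLc : c.L = L) {a a₂ a₂' a₅ Aabs : ℝ}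
variable (hα₆ : 0 < c.α₆) (hε₀ : 0 ≤ c.eps2) (hδ : 0 ≤ c.δ) (hδ7 : 0 ≤ 1 - 7 * c.δ) (hκ : 0 ≤ c.κ) (ha : 0 ≤ a)
  (hR15 : c.R15) (hR16 : 18 * ((1 - 4 * c.δ) * c.κ) ≤ a / 20) (hR16' : 4 * c.κ ≤ a / 20)
  (hR17 : Real.exp (-(a / 20)) ≤ c.eps2) (h231 : 2 * (4 : ℝ) * (Mb : ℝ) ^ 4 * Real.exp (-(a / 10)) ≤ a / 20)
  (ha₂ : 0 ≤ a₂) (hκ229 : kappa₀ 64 8 + a₂ ≤ c.δ * c.κ)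
  (hsm229 : c.α₆ * Real.exp a₂ * K₀ 64 8 * 64 ≤ a₂)
  (habsk : Real.exp (-(a / 20)) * 64 ≤ c.δ * c.κ)
  (h18half : B13Step237.R18half c (K₀ 64 8 * Real.exp (Real.exp (-(a / 20)) * 64)))
  (h18 : B13Step237.R18sharp c (K₀ 64 8 * Real.exp (Real.exp (-(a / 20)) * 64)) ((c.L : ℝ) / 2))
  (ha₂' : 0 ≤ a₂') (hκ229' : kappa₀ 64 8 + a₂' ≤ c.δ * ((c.L : ℝ) / 2) * c.κ)
  (hsm229' : c.α₆ * Real.exp a₂' * K₀ 64 8 * 64 ≤ a₂')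
  (hR20 : 18 * ((1 - 7 * c.δ) * ((c.L : ℝ) / 2) * c.κ) ≤ (c.κ₁ - 1) / 2)
  (ha₅ : 0 ≤ a₅) (habs : a₅ + Real.exp (-((c.κ₁ - 1) / 2)) ≤ Aabs)
  (hAc : Aabs * 64 ≤ c.δ * ((c.L : ℝ) / 2) * c.κ)
  (hC3 : B13Step237.bracketF c (K₀ 64 8 * Real.exp (Real.exp (-(a / 20)) * 64)) / c.α₆ *
    Real.exp (Aabs * 64) ≤ c.C3act * c.ε₁)

include hL hLc hα₆ hε₀ hδ hδ7 hκ ha hR15 hR16 hR16' hR17 h231 ha₂ hκ229 hsm229 habsk h18half h18 ha₂' hκ229' hsm229'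
  hR20 ha₅ habs hAc hC3

variable {G : Type} [GaugeGroup G] (Rr : TwoRuns G)
variable {Op Hist : Type*} [NormedAddCommGroup Op] [NormedSpace ℂ Op] [NormedAddCommGroup Hist] [NormedSpace ℂ Hist]
-- decidability instances as BINDERS (any consumer's instances unify; `Spine/NE5/EnvelopeOnRecord` TECHNICAL NOTE)
variable [∀ j, DecidableEq (TDom 4 (Rr.cubesPerDir j))] [∀ j, DecidableRel (TTouch (d := 4) (N := Rr.cubesPerDir j))]

/-- **N18 ON THE CARRIERS OF RECORD WITH W2 := TERM-LEVEL (2.26) DATA IN THE DATA DIRECTION** [bookkeeping].  For a two-run datum `Rr` and, for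
every member `b ∈ ]0, γ]`, a step model `M b` over `Rr.carriers` whose output at `⟨j, X⟩` IS (2.13) of the TERM SUMS `Σ_{t ∈ terms L M Z} T b j Z t z`
over the printed term catalogue of `H(Z)` (`hrep`), term functions `T b j Z t` of the step's (operator, history) data carrying, around every admissible
box, an open region on which (hol) every term is ℂ-differentiable and (226) obeys (2.26) UNIFORMLY (`hT` — NODE A's per-term estimate on the class
(1.5), NOT instanced), the leaves L01–L03 ∕ L06–L09unit per member, and ONCE [II] Lemma 3's printed restrictions on the constants, L05, the located
numerals `κ + 128·log 162 + 2 ≤ (1−8δ)½L·c.κ`, `C₃ε₁·e^{5κ+1}·K₀(64,8)·576 ≤ 1`, the reach clause and the sharp clause: n18-c's END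
`N18HLayerDatum.ne5_of_leaves_fibre_terms226_record_eps` BY NAME at each member gives `N18At` at the bundle `⟨Rr.carriers, W, γ, κ, EA, EB, θ′, C₅, …⟩`
with ONE `θ′`, ONE `C₅ = ((e·576·K₀(64,8)²·C₃ε₁∕(1−ρ₀))(δ+δ′) + B)(θ′−ω)∕(θ′ − (ω + e·576·K₀(64,8)²·C₃ε₁∕(1−ρ₀)·c_H))` (`C₃ε₁ := c.C3act·c.ε₁`).
[cite: Balaban1988RG2Cluster, (2.13)–(2.14) pp.14–15, (2.26) p.17, Lemma 3 (2.38) p.20; Balaban1987RG1, Thm 1 p.259] -/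
theorem n18At_of_terms226_record (M : ℝ → StepModel Rr.carriers Op Hist)
    (T : ℝ → (j : ℕ) → (Z : TDom 4 (Rr.cubesPerDir j)) →
      Finset (TDom 4 (L * Rr.cubesPerDir j)) × Finset (TBond 4 Mb (L * Rr.cubesPerDir j)) → Op × Hist → ℂ)
    {W : Set (ℕ → ℝ)} {γ κ : ℝ} {EA : Functional Rr.carriers Rr.carriers.BgA} {EB : ℝ → Functional Rr.carriers Rr.carriers.BgB}
    {EA₀ E₀ E₁ δ δ' θ θ' cH ω ρ₀ B : ℝ} {k₀ : ℕ}
    (hrep : ∀ b : ℝ, 0 < b → b ≤ γ → ∀ (X : Rr.carriers.Dom) (z : Op × Hist),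
      (M b).Out X.1 z.1 z.2 X =
        locE (TTouch (d := 4) (N := Rr.cubesPerDir X.1)) (fun Z : (tsys 4 (Rr.cubesPerDir X.1)).Dom => Z.1)
          (fun Z => ∑ t ∈ terms L Mb Z, T b X.1 Z t z) X.2.1)
    (hC3nn : 0 ≤ c.C3act) (hε₁ : 0 ≤ c.ε₁) (hκ0 : 0 ≤ κ)
    (hrate : κ + 2 * (64 * Real.log 162) + 2 ≤ (1 - 8 * c.δ) * ((c.L : ℝ) / 2) * c.κ)
    (hKP : c.C3act * c.ε₁ * Real.exp (5 * κ + 1) * K₀ 64 8 * 9 * 64 ≤ 1)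
    (hT : ∀ b : ℝ, 0 < b → b ≤ γ → ∀ j, ∀ g ∈ W, ∀ (U : Rr.carriers.BgB) (p : Op × Hist), p ∈ (M b).Base j g U →
      ∃ V : Set (Op × Hist), IsOpen V ∧ (M b).box j p ⊆ V ∧
        (∀ (Z : TDom 4 (Rr.cubesPerDir j)), ∀ t ∈ terms L Mb Z, DifferentiableOn ℂ (T b j Z t) V) ∧
        (∀ z ∈ V, ∀ (Z : TDom 4 (Rr.cubesPerDir j)), ∀ t ∈ terms L Mb Z,
          ‖T b j Z t z‖ ≤ weight L Mb c Z a t * Real.exp (a₅ * ((Z.1).card : ℝ))))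
    (l01 : ∀ b : ℝ, 0 < b → b ≤ γ → L01 (M b) EA W) (l02 : ∀ b : ℝ, 0 < b → b ≤ γ → L02 (M b) (EB b) W)
    (l03 : ∀ b : ℝ, 0 < b → b ≤ γ → L03 (M b) (EB b) W) (l05 : L05 EA W EA₀ κ)
    (l06 : ∀ b : ℝ, 0 < b → b ≤ γ → L06 (EB b) W E₀ κ) (l07 : ∀ b : ℝ, 0 < b → b ≤ γ → L07 (M b) W δ θ)
    (l08 : ∀ b : ℝ, 0 < b → b ≤ γ → L08 (M b) W κ E₀ δ' θ) (l09aff : ∀ b : ℝ, 0 < b → b ≤ γ → L09aff (M b) W)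
    (l09blind : ∀ b : ℝ, 0 < b → b ≤ γ → L09blind (M b) W) (l09hom : ∀ b : ℝ, 0 < b → b ≤ γ → L09hom (M b) W)
    (l09unit : ∀ b : ℝ, 0 < b → b ≤ γ → L09unit (M b) W κ E₁ cH ω)
    (hE₁ : 0 < E₁) (hδδ' : 0 ≤ δ + δ') (hθ : 0 ≤ θ) (hθθ' : θ ≤ θ') (hθ'1 : θ' ≤ 1) (hcH : 0 ≤ cH) (hω : 0 < ω)
    (hρ₀ : ρ₀ < 1) (l10near : (δ + δ') * θ ^ k₀ + cH * (EA₀ + E₀) / (1 - ω) ≤ ρ₀) (hB : 0 ≤ B)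
    (l10first : ∀ k < k₀, EA₀ + E₀ ≤ B * θ ^ k)
    (hS : Real.exp 1 * 9 * 64 * K₀ 64 8 ^ 2 * c.C3act * cH * c.ε₁ < (θ' - ω) * (1 - ρ₀))
    (Λ : ℕ → ℕ → ℝ) (C₉ ωm cr ρ : ℝ) :
    N18At ⟨Rr.carriers, W, γ, κ, EA, EB, θ',
      (Real.exp 1 * 9 * 64 * K₀ 64 8 ^ 2 * (c.C3act * c.ε₁) / (1 - ρ₀) * (δ + δ') + B) * (θ' - ω) /
        (θ' - (ω + Real.exp 1 * 9 * 64 * K₀ 64 8 ^ 2 * (c.C3act * c.ε₁) / (1 - ρ₀) * cH)), Λ, C₉, ωm, cr, ρ⟩ :=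
  fun b hb hbγ =>
    ne5_of_leaves_fibre_terms226_record_eps c hL hLc hα₆ hε₀ hδ hδ7 hκ ha hR15 hR16 hR16' hR17 h231 ha₂ hκ229 hsm229 habsk
      h18half h18 ha₂' hκ229' hsm229' hR20 ha₅ habs hAc hC3 Rr (M b) (T b) (hrep b hb hbγ) hC3nn hε₁ hκ0 hrate hKP
      (hT b hb hbγ) (l01 b hb hbγ) (l02 b hb hbγ) (l03 b hb hbγ) l05 (l06 b hb hbγ) (l07 b hb hbγ) (l08 b hb hbγ)
      (l09aff b hb hbγ) (l09blind b hb hbγ) (l09hom b hb hbγ) (l09unit b hb hbγ) hE₁ hδδ' hθ hθθ' hθ'1 hcH hω hρ₀ l10near hB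
      l10first hS

/-- **THE SAME WITH BOTH W2 CLAUSES AS ONE ε₁-THRESHOLD** [bookkeeping]: for Lemma 3's constants with `ω < θ′`, `ρ₀ < 1`, `0 ≤ c_H` there is
`ε⋆ > 0` (`EnvelopeOnRecord.eps_threshold_record` at `C₃ := c.C3act`) such that whenever the record's small-field parameter satisfies
`c.ε₁ < ε⋆`, EVERY member data (step models, term functions, functionals) obeying (2.13) over the term sums, the ∃V-form of (hol) + (226) and the
leaves gives `N18At` with `C₅(c.C3act·c.ε₁)` — the [KP86] clause and the sharp clause DISCHARGED by the smallness of `ε₁`.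
[cite: Balaban1988RG2Cluster, Lemma 3 (2.38)–(2.41) pp.20–21] -/
theorem n18At_of_terms226_record_eps {W : Set (ℕ → ℝ)} {γ κ EA₀ E₀ E₁ δ δ' θ θ' cH ω ρ₀ B : ℝ} {k₀ : ℕ}
    (hC3nn : 0 ≤ c.C3act) (hε₁ : 0 ≤ c.ε₁) (hκ0 : 0 ≤ κ)
    (hrate : κ + 2 * (64 * Real.log 162) + 2 ≤ (1 - 8 * c.δ) * ((c.L : ℝ) / 2) * c.κ)
    (hE₁ : 0 < E₁) (hδδ' : 0 ≤ δ + δ') (hθ : 0 ≤ θ) (hθθ' : θ ≤ θ') (hθ'1 : θ' ≤ 1) (hcH : 0 ≤ cH) (hω : 0 < ω)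
    (hωθ' : ω < θ') (hρ₀ : ρ₀ < 1) (l10near : (δ + δ') * θ ^ k₀ + cH * (EA₀ + E₀) / (1 - ω) ≤ ρ₀) (hB : 0 ≤ B)
    (l10first : ∀ k < k₀, EA₀ + E₀ ≤ B * θ ^ k) (Λ : ℕ → ℕ → ℝ) (C₉ ωm cr ρ : ℝ) :
    ∃ εs : ℝ, 0 < εs ∧ (c.ε₁ < εs →
      ∀ (M : ℝ → StepModel Rr.carriers Op Hist)
        (T : ℝ → (j : ℕ) → (Z : TDom 4 (Rr.cubesPerDir j)) →
          Finset (TDom 4 (L * Rr.cubesPerDir j)) × Finset (TBond 4 Mb (L * Rr.cubesPerDir j)) → Op × Hist → ℂ)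
        (EA : Functional Rr.carriers Rr.carriers.BgA) (EB : ℝ → Functional Rr.carriers Rr.carriers.BgB),
        (∀ b : ℝ, 0 < b → b ≤ γ → ∀ (X : Rr.carriers.Dom) (z : Op × Hist),
          (M b).Out X.1 z.1 z.2 X =
            locE (TTouch (d := 4) (N := Rr.cubesPerDir X.1)) (fun Z : (tsys 4 (Rr.cubesPerDir X.1)).Dom => Z.1)
              (fun Z => ∑ t ∈ terms L Mb Z, T b X.1 Z t z) X.2.1) →
        (∀ b : ℝ, 0 < b → b ≤ γ → ∀ j, ∀ g ∈ W, ∀ (U : Rr.carriers.BgB) (p : Op × Hist), p ∈ (M b).Base j g U →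
          ∃ V : Set (Op × Hist), IsOpen V ∧ (M b).box j p ⊆ V ∧
            (∀ (Z : TDom 4 (Rr.cubesPerDir j)), ∀ t ∈ terms L Mb Z, DifferentiableOn ℂ (T b j Z t) V) ∧
            (∀ z ∈ V, ∀ (Z : TDom 4 (Rr.cubesPerDir j)), ∀ t ∈ terms L Mb Z,
              ‖T b j Z t z‖ ≤ weight L Mb c Z a t * Real.exp (a₅ * ((Z.1).card : ℝ)))) →
        (∀ b : ℝ, 0 < b → b ≤ γ → L01 (M b) EA W) → (∀ b : ℝ, 0 < b → b ≤ γ → L02 (M b) (EB b) W) →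
        (∀ b : ℝ, 0 < b → b ≤ γ → L03 (M b) (EB b) W) → L05 EA W EA₀ κ → (∀ b : ℝ, 0 < b → b ≤ γ → L06 (EB b) W E₀ κ) →
        (∀ b : ℝ, 0 < b → b ≤ γ → L07 (M b) W δ θ) → (∀ b : ℝ, 0 < b → b ≤ γ → L08 (M b) W κ E₀ δ' θ) →
        (∀ b : ℝ, 0 < b → b ≤ γ → L09aff (M b) W) → (∀ b : ℝ, 0 < b → b ≤ γ → L09blind (M b) W) →
        (∀ b : ℝ, 0 < b → b ≤ γ → L09hom (M b) W) → (∀ b : ℝ, 0 < b → b ≤ γ → L09unit (M b) W κ E₁ cH ω) →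
        N18At ⟨Rr.carriers, W, γ, κ, EA, EB, θ',
          (Real.exp 1 * 9 * 64 * K₀ 64 8 ^ 2 * (c.C3act * c.ε₁) / (1 - ρ₀) * (δ + δ') + B) * (θ' - ω) /
            (θ' - (ω + Real.exp 1 * 9 * 64 * K₀ 64 8 ^ 2 * (c.C3act * c.ε₁) / (1 - ρ₀) * cH)), Λ, C₉, ωm, cr, ρ⟩) := by
  obtain ⟨εs, hεs, hthr⟩ := eps_threshold_record (κ := κ) hC3nn hcH hωθ' hρ₀
  refine ⟨εs, hεs, fun hε₁s M T EA EB hrep hT l01 l02 l03 l05 l06 l07 l08 l09aff l09blind l09hom l09unit => ?_⟩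
  obtain ⟨hKP, hS⟩ := hthr c.ε₁ hε₁s
  exact n18At_of_terms226_record c hL hLc hα₆ hε₀ hδ hδ7 hκ ha hR15 hR16 hR16' hR17 h231 ha₂ hκ229 hsm229 habsk h18half h18
    ha₂' hκ229' hsm229' hR20 ha₅ habs hAc hC3 Rr M T hrep hC3nn hε₁ hκ0 hrate hKP hT l01 l02 l03 l05 l06 l07 l08 l09aff
    l09blind l09hom l09unit hE₁ hδδ' hθ hθθ' hθ'1 hcH hω hρ₀ l10near hB l10first hS Λ C₉ ωm cr ρ

end Numerics

end YMDAG.N18.HLayer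

end
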